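import Mathlib.Combinatorics.SimpleGraph.Trails
import Mathlib.Combinatorics.SimpleGraph.DegreeSum
import Mathlib.Combinatorics.SimpleGraph.Connectivity.Connected
import Mathlib.Combinatorics.SimpleGraph.Paths
import HarnessLib

/-!
# Minimal separators and generating sets of the cycle space (Timár's lemma)

Topic `Literature/Combinatorics/SimpleGraph`. The graph-theoretic lemma behind the connectedness of
boundaries in `ℤ^d` (Deuschel–Pisztora, Kesten), in the form isolated by Á. Timár,
*Boundary-connectivity via graph theory*, Proc. AMS 141 (2013) 475–480 (arXiv:0711.1713), Lemma 1:

> Let `S` be a minimal cutset between `x` and `y`, and let `𝒞` be a set of cycles generating every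
> cycle of `G` (over `𝔽₂`). Then for any partition `(S₁, S₂)` of `S` there is some cycle `O ∈ 𝒞`
> that intersects both `S₁` and `S₂`.

Consequently, if every cycle of `𝒞` is *chordal* in a supergraph `G⁺` (any two of its vertices are
`G⁺`-adjacent), minimal cutsets of `G` are `G⁺`-connected (ibid., proof of Thm. 2) — the source of
the `*`-connectedness of exterior boundaries in `ℤ^d` and, in this tree, of the interiors and rims of
Pirogov–Sinai contours.

Everything is over a finite vertex type and elementary: edge sets are `Finset (Sym2 α)`, the cycle
space is handled through vertex-degree parities (`edgeDeg`, `IsEvenEdgeSet`) and the inductive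
`𝔽₂`-span `InSpan 𝒞` (closure of `∅` under symmetric difference with members of `𝒞`); "cutset
between `x` and a vertex set `Y`" replaces Timár's ends (`Y` connected and disjoint from `S`).

* `edgeDeg`, `IsEvenEdgeSet`, `InSpan`, `GeneratesCycles` — the vocabulary;
* `isEvenEdgeSet_symmDiff`, `InSpan.split`, `InSpan.subset_sUnion` — bookkeeping;
* `edgeDeg_pathEdges_odd_iff` — the edge set of a path has odd degree exactly at its two ends;
* `exists_reachable_odd_of_odd` — handshake in a component;
* `exists_generator_meeting_both` — **Timár's lemma**;
* `minimalSeparator_adjacent_across` — the chordal corollary: across any 2-partition of a minimal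
  cutset there is a pair of `G⁺`-adjacent (or equal-cycle) vertices;
* `Crosses`, `even_card_filter_crosses_add_sum_edgeDeg` (cut parity),
  `exists_generator_crossing_both` — the EDGE-boundary version (Friedli–Velenik 2017, App. B,
  Lemma B.83): if `A` and `Aᶜ` are connected, every 2-partition of the edges crossing `A` is met on
  both sides by some generator.

Everything is proved; no named facts.

## References

* Á. Timár, *Boundary-connectivity via graph theory*, Proc. Amer. Math. Soc. 141 (2013) 475–480,
  arXiv:0711.1713: Lemma 1 and the proof of Theorem 2. [Timar2013]
* S. Friedli, Y. Velenik, *Statistical Mechanics of Lattice Systems*, CUP 2017, App. B.15,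
  Lemma B.83 and Prop. B.82. [FriedliVelenik2017]
* J.-D. Deuschel, A. Pisztora, Probab. Theory Related Fields 104 (1996) 467–482, Lemma 2.1;
  H. Kesten, Saint-Flour notes (1986), §2 (the `ℤ^d` statements generalised by Timár).
-/

open Finset SimpleGraph

namespace Literature.Combinatorics.SimpleGraph.CycleSpace

variable {α : Type*}

/-! ### Pairs crossing a vertex set -/

/-- An unordered pair *crosses* the vertex set `A` if exactly one of its two points lies in `A`.
[cite: FriedliVelenik2017, App. B.15 (the ★-edge-boundary ∂_★ A)] -/
def Crosses (A : Finset α) (e : Sym2 α) : Prop :=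
  Sym2.lift ⟨fun x y => (x ∈ A ∧ y ∉ A) ∨ (x ∉ A ∧ y ∈ A), fun x y => propext (by tauto)⟩ e

/-- `s(x, y)` crosses `A` iff exactly one of `x`, `y` is in `A`. [cite: FriedliVelenik2017, App. B.15] -/
@[simp] theorem crosses_mk (A : Finset α) (x y : α) :
    Crosses A s(x, y) ↔ (x ∈ A ∧ y ∉ A) ∨ (x ∉ A ∧ y ∈ A) := Iff.rfl

/-- Crossing a finite vertex set is decidable. [folklore] -/
instance [DecidableEq α] (A : Finset α) : DecidablePred (Crosses A) := fun e =>
  Quot.recOnSubsingleton (motive := fun e => Decidable (Crosses A e)) e fun ⟨x, y⟩ =>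
    inferInstanceAs (Decidable ((x ∈ A ∧ y ∉ A) ∨ (x ∉ A ∧ y ∈ A)))

variable [DecidableEq α]


/-! ### Degrees of edge sets and the `𝔽₂`-span -/

/-- The degree of the vertex `v` in the edge set `Z`: the number of members of `Z` containing `v`.
[cite: Timar2013, §1 (sums of sets of edges modulo 2)] -/
def edgeDeg (Z : Finset (Sym2 α)) (v : α) : ℕ := #(Z.filter (v ∈ ·))

/-- An edge set is *even* (an element of the cycle space) if all its degrees are even.
[cite: Timar2013, §1 (cycles and their sums modulo 2)] -/
def IsEvenEdgeSet (Z : Finset (Sym2 α)) : Prop := ∀ v, Even (edgeDeg Z v)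

/-- The `𝔽₂`-span of a family `𝒞` of edge sets: the closure of `∅` under symmetric difference with
members of `𝒞`. [cite: Timar2013, §1 (generation of cycles by other cycles)] -/
inductive InSpan (𝒞 : Set (Finset (Sym2 α))) : Finset (Sym2 α) → Prop
  | empty : InSpan 𝒞 ∅
  | step {C Z : Finset (Sym2 α)} : C ∈ 𝒞 → InSpan 𝒞 Z → InSpan 𝒞 (symmDiff C Z)

/-- `𝒞` generates the cycle space of `G`: every even edge set made of edges of `G` is in the span of
`𝒞`. [cite: Timar2013, Lemma 1 (hypothesis: 𝒞 generates every cycle in G)] -/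
def GeneratesCycles (G : SimpleGraph α) (𝒞 : Set (Finset (Sym2 α))) : Prop :=
  ∀ Z : Finset (Sym2 α), (∀ e ∈ Z, e ∈ G.edgeSet) → IsEvenEdgeSet Z → InSpan 𝒞 Z

/-- Degree of a symmetric difference, modulo 2. [folklore] -/
theorem even_edgeDeg_symmDiff_iff (A B : Finset (Sym2 α)) (v : α) :
    Even (edgeDeg (symmDiff A B) v) ↔ (Even (edgeDeg A v) ↔ Even (edgeDeg B v)) := by
  unfold edgeDeg
  have hf : (symmDiff A B).filter (v ∈ ·) = symmDiff (A.filter (v ∈ ·)) (B.filter (v ∈ ·)) := by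
    ext e
    simp only [mem_filter, mem_symmDiff]
    tauto
  rw [hf]
  set X := A.filter (v ∈ ·)
  set Y := B.filter (v ∈ ·)
  have hcard : #(symmDiff X Y) + 2 * #(X ∩ Y) = #X + #Y := by
    rw [symmDiff_eq_sup_sdiff_inf]
    have h1 := Finset.card_sdiff_add_card_eq_card (Finset.inter_subset_union (s := X) (t := Y))
    have h2 := Finset.card_union_add_card_inter X Y
    simp only [sup_eq_union, inf_eq_inter] at h1 ⊢
    omega
  constructor
  · intro h
    constructor
    · intro hX
      have : Even (#X + #Y) := by rw [← hcard]; exact h.add (even_two_mul _)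
      exact (Nat.even_add.1 this).1 hX
    · intro hY
      have : Even (#X + #Y) := by rw [← hcard]; exact h.add (even_two_mul _)
      exact (Nat.even_add.1 this).2 hY
  · intro h
    have : Even (#X + #Y) := Nat.even_add.2 h
    rw [← hcard] at this
    exact (Nat.even_add.1 this).2 (even_two_mul _)

/-- Degrees under symmetric difference: `deg_{A ∆ B}(v) + 2 |A_v ∩ B_v| = deg_A(v) + deg_B(v)`. [folklore] -/
theorem edgeDeg_symmDiff_add (A B : Finset (Sym2 α)) (v : α) :
    edgeDeg (symmDiff A B) v + 2 * #(A.filter (v ∈ ·) ∩ B.filter (v ∈ ·)) = edgeDeg A v + edgeDeg B v := by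
  unfold edgeDeg
  have hf : (symmDiff A B).filter (v ∈ ·) = symmDiff (A.filter (v ∈ ·)) (B.filter (v ∈ ·)) := by
    ext e
    simp only [mem_filter, mem_symmDiff]
    tauto
  rw [hf]
  set X := A.filter (v ∈ ·)
  set Y := B.filter (v ∈ ·)
  rw [symmDiff_eq_sup_sdiff_inf]
  have h1 := Finset.card_sdiff_add_card_eq_card (Finset.inter_subset_union (s := X) (t := Y))
  have h2 := Finset.card_union_add_card_inter X Y
  simp only [sup_eq_union, inf_eq_inter] at h1 ⊢
  omega

/-- Parity of the degree sums over a vertex set under symmetric difference. [folklore] -/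
theorem even_sum_edgeDeg_symmDiff_add (A B : Finset (Sym2 α)) (U : Finset α) :
    Even (∑ v ∈ U, edgeDeg (symmDiff A B) v + ∑ v ∈ U, edgeDeg A v + ∑ v ∈ U, edgeDeg B v) := by
  have h : ∀ v ∈ U, edgeDeg (symmDiff A B) v + edgeDeg A v + edgeDeg B v =
      2 * (edgeDeg A v + edgeDeg B v - #(A.filter (v ∈ ·) ∩ B.filter (v ∈ ·))) := by
    intro v _
    have h1 := edgeDeg_symmDiff_add A B v
    have h2 : #(A.filter (v ∈ ·) ∩ B.filter (v ∈ ·)) ≤ edgeDeg A v := Finset.card_le_card Finset.inter_subset_left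
    omega
  rw [← Finset.sum_add_distrib, ← Finset.sum_add_distrib, Finset.sum_congr rfl h, ← Finset.mul_sum]
  exact even_two_mul _

/-- The symmetric difference of even edge sets is even. [folklore] -/
theorem isEvenEdgeSet_symmDiff {A B : Finset (Sym2 α)} (hA : IsEvenEdgeSet A) (hB : IsEvenEdgeSet B) :
    IsEvenEdgeSet (symmDiff A B) := fun v =>
  (even_edgeDeg_symmDiff_iff A B v).2 ⟨fun _ => hB v, fun _ => hA v⟩

/-- The span consists of even sets when the generators are even. [folklore] -/
theorem InSpan.isEvenEdgeSet {𝒞 : Set (Finset (Sym2 α))} (h𝒞 : ∀ C ∈ 𝒞, IsEvenEdgeSet C)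
    {Z : Finset (Sym2 α)} (hZ : InSpan 𝒞 Z) : IsEvenEdgeSet Z := by
  induction hZ with
  | empty => intro v; simp [edgeDeg]
  | step hC _ ih => exact isEvenEdgeSet_symmDiff (h𝒞 _ hC) ih

/-- The span is closed under symmetric difference. [folklore] -/
theorem inSpan_symmDiff {𝒞 : Set (Finset (Sym2 α))} {Z Z' : Finset (Sym2 α)} (hZ : InSpan 𝒞 Z)
    (hZ' : InSpan 𝒞 Z') : InSpan 𝒞 (symmDiff Z Z') := by
  induction hZ with
  | empty => rwa [bot_eq_empty.symm, bot_symmDiff]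
  | step hC _ ih => rw [symmDiff_assoc]; exact InSpan.step hC ih

/-- Monotonicity of the span in the family. [folklore] -/
theorem InSpan.mono {𝒞 𝒟 : Set (Finset (Sym2 α))} (h : 𝒞 ⊆ 𝒟) {Z : Finset (Sym2 α)} (hZ : InSpan 𝒞 Z) :
    InSpan 𝒟 Z := by
  induction hZ with
  | empty => exact InSpan.empty
  | step hC _ ih => exact InSpan.step (h hC) ih

/-- Every edge of a set in the span lies in some generator used. [folklore] -/
theorem InSpan.exists_mem {𝒞 : Set (Finset (Sym2 α))} {Z : Finset (Sym2 α)} (hZ : InSpan 𝒞 Z) {e : Sym2 α}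
    (he : e ∈ Z) : ∃ C ∈ 𝒞, e ∈ C := by
  induction hZ with
  | empty => simp at he
  | @step C Z' hC _ ih =>
    rw [mem_symmDiff] at he
    rcases he with ⟨h, -⟩ | ⟨h, -⟩
    · exact ⟨C, hC, h⟩
    · exact ih h

/-- **Splitting a span along a property of the generators**: `Z = Z₁ ∆ Z₂` with `Z₁` in the span of
the generators satisfying `P` and `Z₂` in the span of the others.
[cite: Timar2013, Lemma 1 (proof: A = A₁ ∪ A₂)] -/
theorem InSpan.split {𝒞 : Set (Finset (Sym2 α))} (P : Finset (Sym2 α) → Prop) {Z : Finset (Sym2 α)}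
    (hZ : InSpan 𝒞 Z) :
    ∃ Z₁ Z₂ : Finset (Sym2 α), InSpan {C | C ∈ 𝒞 ∧ P C} Z₁ ∧ InSpan {C | C ∈ 𝒞 ∧ ¬P C} Z₂ ∧
      Z = symmDiff Z₁ Z₂ := by
  classical
  induction hZ with
  | empty => exact ⟨∅, ∅, InSpan.empty, InSpan.empty, by simp⟩
  | @step C Z' hC _ ih =>
    obtain ⟨Z₁, Z₂, h₁, h₂, rfl⟩ := ih
    by_cases hP : P C
    · exact ⟨symmDiff C Z₁, Z₂, InSpan.step ⟨hC, hP⟩ h₁, h₂, by rw [symmDiff_assoc]⟩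
    · refine ⟨Z₁, symmDiff C Z₂, h₁, InSpan.step ⟨hC, hP⟩ h₂, ?_⟩
      rw [symmDiff_left_comm]

/-! ### Edge sets of paths -/

section Paths

variable {G : SimpleGraph α}

/-- The edge set of a walk, as a finite set. [folklore] -/
def walkEdges {u v : α} (p : G.Walk u v) : Finset (Sym2 α) := p.edges.toFinset

/-- Edges of a walk are edges of the graph. [folklore] -/
theorem mem_edgeSet_of_mem_walkEdges {u v : α} (p : G.Walk u v) {e : Sym2 α} (he : e ∈ walkEdges p) :
    e ∈ G.edgeSet :=
  p.edges_subset_edgeSet (List.mem_toFinset.1 he)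

/-- A vertex on an edge of a walk is on the walk. [folklore] -/
theorem mem_support_of_mem_walkEdges {u v : α} (p : G.Walk u v) {e : Sym2 α} (he : e ∈ walkEdges p)
    {w : α} (hw : w ∈ e) : w ∈ p.support := by
  rw [walkEdges, List.mem_toFinset] at he
  induction e using Sym2.ind with
  | h a b =>
    rcases Sym2.mem_iff.1 hw with rfl | rfl
    · exact p.fst_mem_support_of_mem_edges he
    · exact p.snd_mem_support_of_mem_edges he

/-- **Parity of the edge set of a path**: for a path from `u` to `v ≠ u`, the degree of `w` in its
edge set is odd iff `w = u` or `w = v`. [folklore] -/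
theorem odd_edgeDeg_walkEdges_iff {u v : α} {p : G.Walk u v} (hp : p.IsPath) (huv : u ≠ v) (w : α) :
    Odd (edgeDeg (walkEdges p) w) ↔ w = u ∨ w = v := by
  have hnd : p.edges.Nodup := hp.isTrail.edges_nodup
  have hcount : edgeDeg (walkEdges p) w = p.edges.countP (fun e => w ∈ e) := by
    rw [edgeDeg, walkEdges, List.countP_eq_length_filter, ← List.toFinset_card_of_nodup (hnd.filter _),
      List.toFinset_filter]
    congr 1
    ext e
    simp
  rw [hcount, ← Nat.not_even_iff_odd, hp.isTrail.even_countP_edges_iff w]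
  tauto

end Paths

/-! ### Handshake in a connected component -/

section Handshake

variable [Fintype α]

/-- The degree of `v` in the graph spanned by an edge set `Q` of genuine edges (no loops) is the
degree of `v` in `Q`. [folklore] -/
theorem degree_fromEdgeSet_eq_edgeDeg (Q : Finset (Sym2 α)) (hQ : ∀ e ∈ Q, ¬e.IsDiag)
    [DecidableRel (fromEdgeSet (↑Q : Set (Sym2 α))).Adj] (v : α) :
    (fromEdgeSet (↑Q : Set (Sym2 α))).degree v = edgeDeg Q v := by
  classical
  rw [← card_neighborFinset_eq_degree, edgeDeg]
  refine Finset.card_bij (fun w _ => s(v, w)) (fun w hw => ?_) (fun w₁ h₁ w₂ h₂ h => ?_) (fun e he => ?_)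
  · rw [mem_neighborFinset, fromEdgeSet_adj, Finset.mem_coe] at hw
    exact mem_filter.2 ⟨hw.1, Sym2.mem_mk_left _ _⟩
  · exact Sym2.congr_right.1 h
  · obtain ⟨heQ, hve⟩ := mem_filter.1 he
    obtain ⟨w, rfl⟩ : ∃ w, e = s(v, w) := by
      induction e using Sym2.ind with
      | h a b =>
        rcases Sym2.mem_iff.1 hve with rfl | rfl
        · exact ⟨b, rfl⟩
        · exact ⟨a, Sym2.eq_swap⟩
    refine ⟨w, ?_, rfl⟩
    rw [mem_neighborFinset, fromEdgeSet_adj, Finset.mem_coe]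
    exact ⟨heQ, fun h => hQ _ heQ (by rw [h]; exact rfl)⟩

/-- **Handshake in a component**: in the graph spanned by a loop-free edge set `Q`, a vertex of odd
`Q`-degree is joined to another vertex of odd `Q`-degree. [folklore] -/
theorem exists_reachable_odd_of_odd (Q : Finset (Sym2 α)) (hQ : ∀ e ∈ Q, ¬e.IsDiag) {x : α}
    (hx : Odd (edgeDeg Q x)) :
    ∃ w : α, w ≠ x ∧ (fromEdgeSet (↑Q : Set (Sym2 α))).Reachable x w ∧ Odd (edgeDeg Q w) := by
  classical
  set H := fromEdgeSet (↑Q : Set (Sym2 α)) with hH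
  -- restrict `H` to the component of `x`: keep the edges whose endpoints are reachable from `x`
  set K : SimpleGraph α := H ⊓ SimpleGraph.fromRel (fun a _ => H.Reachable x a) with hK
  have hKadj : ∀ a b, K.Adj a b ↔ H.Adj a b ∧ H.Reachable x a := by
    intro a b
    simp only [hK, inf_adj, SimpleGraph.fromRel_adj, ne_eq]
    constructor
    · rintro ⟨hab, -, h | h⟩
      · exact ⟨hab, h⟩
      · exact ⟨hab, h.trans hab.symm.reachable⟩
    · rintro ⟨hab, h⟩
      exact ⟨hab, hab.ne, Or.inl h⟩
  have hdegK : ∀ a, K.degree a = if H.Reachable x a then H.degree a else 0 := by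
    intro a
    split_ifs with h
    · rw [← card_neighborFinset_eq_degree, ← card_neighborFinset_eq_degree]
      congr 1
      ext b
      rw [mem_neighborFinset, mem_neighborFinset, hKadj]
      tauto
    · rw [← card_neighborFinset_eq_degree, Finset.card_eq_zero, Finset.eq_empty_iff_forall_notMem]
      intro b hb
      rw [mem_neighborFinset, hKadj] at hb
      exact h hb.2
  have hxK : Odd (K.degree x) := by
    rw [hdegK, if_pos (Reachable.refl x), degree_fromEdgeSet_eq_edgeDeg Q hQ]
    exact hx
  obtain ⟨w, hwx, hw⟩ := K.exists_ne_odd_degree_of_exists_odd_degree x hxK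
  rw [hdegK] at hw
  by_cases hr : H.Reachable x w
  · rw [if_pos hr, degree_fromEdgeSet_eq_edgeDeg Q hQ] at hw
    exact ⟨w, hwx, hr, hw⟩
  · rw [if_neg hr] at hw
    exact absurd hw (by decide)

end Handshake

/-! ### Timár's lemma -/

section Timar

variable [Fintype α] {G : SimpleGraph α}

omit [DecidableEq α] [Fintype α] in
/-- The support of a walk in the graph spanned by `Q` consists of its start and of vertices lying on
edges of `Q`. [folklore] -/
theorem support_subset_of_walk_fromEdgeSet {Q : Finset (Sym2 α)} {u v : α}
    (p : (fromEdgeSet (↑Q : Set (Sym2 α))).Walk u v) :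
    ∀ w ∈ p.support, w = u ∨ ∃ e ∈ Q, w ∈ e := by
  induction p with
  | nil => intro w hw; rw [Walk.support_nil, List.mem_singleton] at hw; exact Or.inl hw
  | @cons a b c hab p ih =>
    intro w hw
    rw [Walk.support_cons, List.mem_cons] at hw
    rcases hw with rfl | hw
    · exact Or.inl rfl
    · rcases ih w hw with rfl | h
      · rw [fromEdgeSet_adj, Finset.mem_coe] at hab
        exact Or.inr ⟨_, hab.1, Sym2.mem_mk_right _ _⟩
      · exact Or.inr h

/-- **Timár's lemma** (Timár 2013, Lemma 1), finite form with the end replaced by a vertex set.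
Let `𝒞` generate the cycle space of `G`. Let `S` be a set of vertices separating a vertex
`x ∉ S` from a `G`-connected vertex set `Y` disjoint from `S` (every walk from `x` to `Y` meets `S`),
minimal in the sense that for each `s ∈ S` some walk from `x` to `Y` meets `S` only in `s`. Then for
every partition of `S` into two non-empty parts `S₁, S₂`, some generator `C ∈ 𝒞` has a vertex in
`S₁` and a vertex in `S₂`.
Proof (ibid.): paths `P₁`, `P₂` from `x` to `Y` avoiding `S₂`, resp. `S₁`, closed up inside `Y`;
`P₁ + P₂ = ∑_{C ∈ A} C`; if no generator met both parts, `P₁ + ∑_{A₁} C = P₂ + ∑_{A₂} C` would avoid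
`S` and contain an `x`–`Y` path (handshake). [cite: Timar2013, Lemma 1] -/
theorem exists_generator_meeting_both {𝒞 : Set (Finset (Sym2 α))} (hgen : GeneratesCycles G 𝒞)
    (h𝒞 : ∀ C ∈ 𝒞, IsEvenEdgeSet C) (h𝒞E : ∀ C ∈ 𝒞, ∀ e ∈ C, e ∈ G.edgeSet)
    {x : α} {Y : Set α} {S : Finset α} (hxS : x ∉ S) (hYS : ∀ y ∈ Y, y ∉ S)
    (hY : ∀ y ∈ Y, ∀ y' ∈ Y, ∃ p : G.Walk y y', ∀ w ∈ p.support, w ∈ Y)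
    (hsep : ∀ y ∈ Y, ∀ p : G.Walk x y, ∃ s ∈ S, s ∈ p.support)
    (hmin : ∀ s ∈ S, ∃ y ∈ Y, ∃ p : G.Walk x y, ∀ w ∈ p.support, w ∈ S → w = s)
    {S₁ S₂ : Finset α} (hS : ∀ s, s ∈ S ↔ s ∈ S₁ ∨ s ∈ S₂) (h₁ : S₁.Nonempty) (h₂ : S₂.Nonempty)
    (h₁₂ : Disjoint S₁ S₂) :
    ∃ C ∈ 𝒞, (∃ e ∈ C, ∃ s ∈ S₁, s ∈ e) ∧ (∃ e ∈ C, ∃ s ∈ S₂, s ∈ e) := by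
  classical
  by_contra hcon
  push Not at hcon
  -- paths avoiding `S₂`, resp. `S₁`
  obtain ⟨s₁, hs₁⟩ := h₁
  obtain ⟨s₂, hs₂⟩ := h₂
  obtain ⟨y₁, hy₁, p₁, hp₁⟩ := hmin s₁ ((hS s₁).2 (Or.inl hs₁))
  obtain ⟨y₂, hy₂, p₂, hp₂⟩ := hmin s₂ ((hS s₂).2 (Or.inr hs₂))
  obtain ⟨r, hr⟩ := hY y₂ hy₂ y₁ hy₁
  -- both walks end at `y₁`
  set q₁ : G.Walk x y₁ := p₁.bypass with hq₁
  set q₂ : G.Walk x y₁ := (p₂.append r).bypass with hq₂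
  have hq₁S₂ : ∀ w ∈ q₁.support, w ∉ S₂ := by
    intro w hw hw₂
    have hwS : w ∈ S := (hS w).2 (Or.inr hw₂)
    have := hp₁ w (p₁.support_bypass_subset_support hw) hwS
    subst this
    exact Finset.disjoint_left.1 h₁₂ hs₁ hw₂
  have hq₂S₁ : ∀ w ∈ q₂.support, w ∉ S₁ := by
    intro w hw hw₁
    have hwS : w ∈ S := (hS w).2 (Or.inl hw₁)
    have hw' := (p₂.append r).support_bypass_subset_support hw
    rw [Walk.mem_support_append_iff] at hw'
    rcases hw' with hw' | hw'
    · have := hp₂ w hw' hwS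
      subst this
      exact Finset.disjoint_left.1 h₁₂ hw₁ hs₂
    · exact hYS w (hr w hw') hwS
  have hxy : x ≠ y₁ := by
    rintro rfl
    obtain ⟨s, hs, hsx⟩ := hsep x hy₁ Walk.nil
    rw [Walk.support_nil, List.mem_singleton] at hsx
    exact hxS (hsx ▸ hs)
  set E₁ := walkEdges q₁ with hE₁
  set E₂ := walkEdges q₂ with hE₂
  -- `E₁ ∆ E₂` is even, made of edges of `G`, hence in the span
  have hpath₁ : q₁.IsPath := p₁.bypass_isPath
  have hpath₂ : q₂.IsPath := (p₂.append r).bypass_isPath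
  have hZeven : IsEvenEdgeSet (symmDiff E₁ E₂) := by
    intro w
    rw [even_edgeDeg_symmDiff_iff, ← not_iff_not, Nat.not_even_iff_odd, Nat.not_even_iff_odd,
      odd_edgeDeg_walkEdges_iff hpath₁ hxy, odd_edgeDeg_walkEdges_iff hpath₂ hxy]
  have hZedges : ∀ e ∈ symmDiff E₁ E₂, e ∈ G.edgeSet := by
    intro e he
    rw [mem_symmDiff] at he
    rcases he with ⟨h, -⟩ | ⟨h, -⟩
    · exact mem_edgeSet_of_mem_walkEdges q₁ h
    · exact mem_edgeSet_of_mem_walkEdges q₂ h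
  have hZ : InSpan 𝒞 (symmDiff E₁ E₂) := hgen _ hZedges hZeven
  -- split along "meets `S₁`"
  obtain ⟨Z₁, Z₂, hZ₁, hZ₂, hZeq⟩ := hZ.split (fun C => ∃ e ∈ C, ∃ s ∈ S₁, s ∈ e)
  -- the generators in `Z₁` avoid `S₂`, those in `Z₂` avoid `S₁`
  have hZ₁S₂ : ∀ e ∈ Z₁, ∀ s ∈ S₂, s ∉ e := by
    intro e he s hs hse
    obtain ⟨C, ⟨hC, hP⟩, heC⟩ := hZ₁.exists_mem he
    exact hcon C hC hP e heC s hs hse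
  have hZ₂S₁ : ∀ e ∈ Z₂, ∀ s ∈ S₁, s ∉ e := by
    intro e he s hs hse
    obtain ⟨C, ⟨_, hP⟩, heC⟩ := hZ₂.exists_mem he
    exact hP ⟨e, heC, s, hs, hse⟩
  -- `Q := E₁ ∆ Z₁ = E₂ ∆ Z₂`
  set Q := symmDiff E₁ Z₁ with hQdef
  have hQ' : Q = symmDiff E₂ Z₂ := by
    rw [hQdef, ← symmDiff_symmDiff_cancel_right Z₂ Z₁, ← hZeq, ← symmDiff_assoc,
      symmDiff_symmDiff_cancel_left]
  -- `Q` avoids `S`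
  have hQS : ∀ e ∈ Q, ∀ s ∈ S, s ∉ e := by
    intro e he s hs hse
    rcases (hS s).1 hs with hs₁ | hs₂
    · rw [hQ', mem_symmDiff] at he
      rcases he with ⟨h, -⟩ | ⟨h, -⟩
      · exact hq₂S₁ s (mem_support_of_mem_walkEdges q₂ h hse) hs₁
      · exact hZ₂S₁ e h s hs₁ hse
    · rw [hQdef, mem_symmDiff] at he
      rcases he with ⟨h, -⟩ | ⟨h, -⟩
      · exact hq₁S₂ s (mem_support_of_mem_walkEdges q₁ h hse) hs₂
      · exact hZ₁S₂ e h s hs₂ hse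
  -- `Q` is loop-free and has odd degree exactly at `x` and `y₁`
  have h𝒞₁ : ∀ C ∈ {C | C ∈ 𝒞 ∧ ∃ e ∈ C, ∃ s ∈ S₁, s ∈ e}, IsEvenEdgeSet C := fun C hC => h𝒞 C hC.1
  have hZ₁even : IsEvenEdgeSet Z₁ := hZ₁.isEvenEdgeSet h𝒞₁
  have hQodd : ∀ w, Odd (edgeDeg Q w) ↔ w = x ∨ w = y₁ := by
    intro w
    rw [← odd_edgeDeg_walkEdges_iff hpath₁ hxy w, ← Nat.not_even_iff_odd, ← Nat.not_even_iff_odd,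
      hQdef, even_edgeDeg_symmDiff_iff]
    have := hZ₁even w
    tauto
  have hZ₁E : ∀ e ∈ Z₁, e ∈ G.edgeSet := fun e he => by
    obtain ⟨C, ⟨hC, -⟩, heC⟩ := hZ₁.exists_mem he
    exact h𝒞E C hC e heC
  have hQedges : ∀ e ∈ Q, e ∈ G.edgeSet := by
    intro e he
    rw [hQdef, mem_symmDiff] at he
    rcases he with ⟨h, -⟩ | ⟨h, -⟩
    · exact mem_edgeSet_of_mem_walkEdges q₁ h
    · exact hZ₁E e h
  have hQdiag : ∀ e ∈ Q, ¬e.IsDiag := fun e he => G.not_isDiag_of_mem_edgeSet (hQedges e he)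
  -- handshake: `x` is joined in `Q` to the other odd vertex, `y₁`
  obtain ⟨w, hwx, hreach, hwodd⟩ := exists_reachable_odd_of_odd Q hQdiag ((hQodd x).2 (Or.inl rfl))
  have hw : w = y₁ := ((hQodd w).1 hwodd).resolve_left hwx
  subst hw
  obtain ⟨walk⟩ := hreach
  have hwalkS : ∀ v ∈ walk.support, v ∉ S := by
    intro v hv hvS
    rcases support_subset_of_walk_fromEdgeSet walk v hv with rfl | ⟨e, he, hve⟩
    · exact hxS hvS
    · exact hQS e he v hvS hve
  -- transfer the walk to `G`: it joins `x` to `Y` avoiding `S`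
  have hedges : ∀ e ∈ walk.edges, e ∈ G.edgeSet := by
    intro e he
    have h := walk.edges_subset_edgeSet he
    rw [edgeSet_fromEdgeSet] at h
    exact hQedges e h.1
  obtain ⟨s, hs, hsupp⟩ := hsep _ hy₁ (walk.transfer G hedges)
  rw [Walk.support_transfer] at hsupp
  exact hwalkS s hsupp hs

/-- **Minimal cutsets are connected in a supergraph in which the generators are chordal** (Timár
2013, proof of Thm. 2, first paragraph): under the hypotheses of `exists_generator_meeting_both`, if
every generator is *chordal* for a relation `adj⁺` (any two distinct vertices lying on edges of the
generator are `adj⁺`-related), then across every 2-partition of `S` there are `s₁ ∈ S₁`, `s₂ ∈ S₂`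
with `adj⁺ s₁ s₂`. Hence `S` is connected for `adj⁺`. [cite: Timar2013, Thm. 2 (proof)] -/
theorem minimalSeparator_adjacent_across {𝒞 : Set (Finset (Sym2 α))} (hgen : GeneratesCycles G 𝒞)
    (h𝒞 : ∀ C ∈ 𝒞, IsEvenEdgeSet C) (h𝒞E : ∀ C ∈ 𝒞, ∀ e ∈ C, e ∈ G.edgeSet)
    {adjPlus : α → α → Prop}
    (hchordal : ∀ C ∈ 𝒞, ∀ e ∈ C, ∀ e' ∈ C, ∀ a ∈ e, ∀ b ∈ e', a ≠ b → adjPlus a b)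
    {x : α} {Y : Set α} {S : Finset α} (hxS : x ∉ S) (hYS : ∀ y ∈ Y, y ∉ S)
    (hY : ∀ y ∈ Y, ∀ y' ∈ Y, ∃ p : G.Walk y y', ∀ w ∈ p.support, w ∈ Y)
    (hsep : ∀ y ∈ Y, ∀ p : G.Walk x y, ∃ s ∈ S, s ∈ p.support)
    (hmin : ∀ s ∈ S, ∃ y ∈ Y, ∃ p : G.Walk x y, ∀ w ∈ p.support, w ∈ S → w = s)
    {S₁ S₂ : Finset α} (hS : ∀ s, s ∈ S ↔ s ∈ S₁ ∨ s ∈ S₂) (h₁ : S₁.Nonempty) (h₂ : S₂.Nonempty)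
    (h₁₂ : Disjoint S₁ S₂) :
    ∃ s₁ ∈ S₁, ∃ s₂ ∈ S₂, adjPlus s₁ s₂ := by
  obtain ⟨C, hC, ⟨e, he, s₁, hs₁, hse⟩, ⟨e', he', s₂, hs₂, hse'⟩⟩ :=
    exists_generator_meeting_both hgen h𝒞 h𝒞E hxS hYS hY hsep hmin hS h₁ h₂ h₁₂
  exact ⟨s₁, hs₁, s₂, hs₂, hchordal C hC e he e' he' s₁ hse s₂ hse'
    (fun h => Finset.disjoint_left.1 h₁₂ hs₁ (h ▸ hs₂))⟩


/-- A finite sum of even naturals is even. [folklore] -/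
theorem even_finsetSum {ι : Type*} (s : Finset ι) {f : ι → ℕ} (h : ∀ i ∈ s, Even (f i)) :
    Even (∑ i ∈ s, f i) := by
  classical
  induction s using Finset.induction with
  | empty => simp
  | @insert a s has ih =>
    rw [Finset.sum_insert has]
    exact (h a (Finset.mem_insert_self a s)).add (ih fun i hi => h i (Finset.mem_insert_of_mem hi))

/-! ### Edge boundaries: the Friedli–Velenik / Timár boundary lemma -/

omit [Fintype α] in
/-- **Cut parity**: for a loop-free edge set `F` and a vertex set `A`, the number of members of `F`
crossing `A` has the parity of `∑_{v ∈ A} deg_F(v)` (double counting: an edge inside `A`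
contributes `2`, a crossing edge `1`). [folklore] -/
theorem even_card_filter_crosses_add_sum_edgeDeg (F : Finset (Sym2 α)) (hF : ∀ e ∈ F, ¬e.IsDiag)
    (A : Finset α) : Even (#(F.filter (Crosses A)) + ∑ v ∈ A, edgeDeg F v) := by
  classical
  -- double counting
  have hswap : ∑ v ∈ A, edgeDeg F v = ∑ e ∈ F, #(A.filter (· ∈ e)) := by
    unfold edgeDeg
    simp only [Finset.card_eq_sum_ones, Finset.sum_filter]
    rw [Finset.sum_comm]
  rw [hswap, Finset.card_eq_sum_ones, Finset.sum_filter, ← Finset.sum_add_distrib]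
  refine even_finsetSum _ fun e he => ?_
  induction e using Sym2.ind with
  | h x y =>
    have hxy : x ≠ y := fun h => hF _ he (by rw [h]; exact rfl)
    have hcard : #(A.filter (· ∈ s(x, y))) = (if x ∈ A then 1 else 0) + (if y ∈ A then 1 else 0) := by
      have : A.filter (· ∈ s(x, y)) = A.filter (fun v => v = x ∨ v = y) := by
        ext v; simp [Sym2.mem_iff]
      rw [this, Finset.filter_or, Finset.card_union_of_disjoint]
      · congr 1
        · by_cases hx : x ∈ A
          · rw [if_pos hx, Finset.filter_eq' A x, if_pos hx, Finset.card_singleton]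
          · rw [if_neg hx, Finset.filter_eq' A x, if_neg hx, Finset.card_empty]
        · by_cases hy : y ∈ A
          · rw [if_pos hy, Finset.filter_eq' A y, if_pos hy, Finset.card_singleton]
          · rw [if_neg hy, Finset.filter_eq' A y, if_neg hy, Finset.card_empty]
      · rw [Finset.disjoint_left]
        intro v hv hv'
        rw [Finset.mem_filter] at hv hv'
        exact hxy (hv.2.symm.trans hv'.2)
    rw [hcard]
    by_cases hx : x ∈ A <;> by_cases hy : y ∈ A <;> simp [crosses_mk, hx, hy]

omit [DecidableEq α] [Fintype α] in
/-- The edges of a walk staying inside `A` do not cross `A`. [folklore] -/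
theorem not_crosses_of_support_subset {u v : α} (p : G.Walk u v) {A : Finset α}
    (hp : ∀ w ∈ p.support, w ∈ A) {e : Sym2 α} (he : e ∈ p.edges) : ¬Crosses A e := by
  induction e using Sym2.ind with
  | h x y =>
    rw [crosses_mk]
    have hx := hp x (p.fst_mem_support_of_mem_edges he)
    have hy := hp y (p.snd_mem_support_of_mem_edges he)
    simp [hx, hy]

omit [DecidableEq α] [Fintype α] in
/-- The edges of a walk staying outside `A` do not cross `A`. [folklore] -/
theorem not_crosses_of_support_disjoint {u v : α} (p : G.Walk u v) {A : Finset α}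
    (hp : ∀ w ∈ p.support, w ∉ A) {e : Sym2 α} (he : e ∈ p.edges) : ¬Crosses A e := by
  induction e using Sym2.ind with
  | h x y =>
    rw [crosses_mk]
    have hx := hp x (p.fst_mem_support_of_mem_edges he)
    have hy := hp y (p.snd_mem_support_of_mem_edges he)
    simp [hx, hy]

omit [Fintype α] in
/-- **The boundary lemma of Friedli–Velenik (App. B, Lemma B.83), abstract form** (the idea is
Timár's): let `𝒞` generate the cycle space of `G`, let `A` be a set of vertices such that both `A`
and its complement are `G`-connected, and let the edges of `G` crossing `A` be partitioned into
two non-empty classes `E₁`, `E₂`. Then some generator `C ∈ 𝒞` contains an edge of `E₁` and an edge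
of `E₂`.
Proof (ibid.): for `e₁ = u₁v₁ ∈ E₁` and `e₂ ∈ E₂` take the path `π₁ = e₁` and a path `π₂` from
`u₁` to `v₁` through `e₂`, inside `A` before and inside `Aᶜ` after; `π₁ + π₂ = ∑_A C`; split
`A = A₁ ⊔ A₂` by "meets `E₁`"; `F = π₂ + ∑_{A₂} C` avoids `E₁`, and by cut parity `|F ∩ ∂A|` is odd,
so `F` meets `E₂`; as `F = π₁ + ∑_{A₁} C` and `π₁ = {e₁}`, some `C ∈ A₁` meets `E₂`.
[cite: FriedliVelenik2017, App. B, Lemma B.83] -/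
theorem exists_generator_crossing_both {𝒞 : Set (Finset (Sym2 α))} (hgen : GeneratesCycles G 𝒞)
    (h𝒞 : ∀ C ∈ 𝒞, IsEvenEdgeSet C) (h𝒞E : ∀ C ∈ 𝒞, ∀ e ∈ C, e ∈ G.edgeSet)
    {A : Finset α} (hA : ∀ a ∈ A, ∀ a' ∈ A, ∃ p : G.Walk a a', ∀ w ∈ p.support, w ∈ A)
    (hAc : ∀ b ∉ A, ∀ b' ∉ A, ∃ p : G.Walk b b', ∀ w ∈ p.support, w ∉ A)
    {E₁ E₂ : Finset (Sym2 α)} (hE : ∀ e, e ∈ E₁ ∨ e ∈ E₂ ↔ e ∈ G.edgeSet ∧ Crosses A e)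
    (h₁ : E₁.Nonempty) (h₂ : E₂.Nonempty) (h₁₂ : Disjoint E₁ E₂) :
    ∃ C ∈ 𝒞, (∃ e ∈ C, e ∈ E₁) ∧ (∃ e ∈ C, e ∈ E₂) := by
  classical
  -- orient `e₁ ∈ E₁` and `e₂ ∈ E₂` from `A` to `Aᶜ`
  have horient : ∀ e : Sym2 α, e ∈ G.edgeSet ∧ Crosses A e →
      ∃ u w : α, e = s(u, w) ∧ G.Adj u w ∧ u ∈ A ∧ w ∉ A := by
    intro e he
    induction e using Sym2.ind with
    | h x y =>
      rw [crosses_mk] at he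
      rcases he.2 with ⟨hx, hy⟩ | ⟨hx, hy⟩
      · exact ⟨x, y, rfl, he.1, hx, hy⟩
      · exact ⟨y, x, Sym2.eq_swap, he.1.symm, hy, hx⟩
  obtain ⟨e₁, he₁⟩ := h₁
  obtain ⟨e₂, he₂⟩ := h₂
  obtain ⟨u₁, v₁, rfl, hadj₁, hu₁, hv₁⟩ := horient e₁ ((hE e₁).1 (Or.inl he₁))
  obtain ⟨u₂, v₂, rfl, hadj₂, hu₂, hv₂⟩ := horient e₂ ((hE e₂).1 (Or.inr he₂))
  -- `π₂`: inside `A` from `u₁` to `u₂`, across `e₂`, outside `A` from `v₂` to `v₁`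
  obtain ⟨a, ha⟩ := hA u₁ hu₁ u₂ hu₂
  obtain ⟨b, hb⟩ := hAc v₂ hv₂ v₁ hv₁
  set π₂ : G.Walk u₁ v₁ := a.append (Walk.cons hadj₂ b) with hπ₂
  have hπ₂E₁ : ∀ e ∈ π₂.edges, e ∉ E₁ := by
    intro e he heE₁
    rw [hπ₂, Walk.edges_append, List.mem_append, Walk.edges_cons, List.mem_cons] at he
    rcases he with he | rfl | he
    · exact not_crosses_of_support_subset a ha he ((hE e).1 (Or.inl heE₁)).2
    · exact Finset.disjoint_left.1 h₁₂ heE₁ he₂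
    · exact not_crosses_of_support_disjoint b hb he ((hE e).1 (Or.inl heE₁)).2
  set q₂ : G.Walk u₁ v₁ := π₂.bypass with hq₂
  have hq₂E₁ : ∀ e ∈ walkEdges q₂, e ∉ E₁ := fun e he =>
    hπ₂E₁ e (π₂.edges_bypass_subset_edges (List.mem_toFinset.1 he))
  have huv : u₁ ≠ v₁ := hadj₁.ne
  -- `π₁ = e₁`
  set q₁ : G.Walk u₁ v₁ := Walk.cons hadj₁ Walk.nil with hq₁
  have hq₁path : q₁.IsPath := by
    rw [hq₁, Walk.cons_isPath_iff]; exact ⟨Walk.IsPath.nil, by simp [huv]⟩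
  have hE₁q₁ : walkEdges q₁ = {s(u₁, v₁)} := by simp [walkEdges, hq₁]
  have hq₂path : q₂.IsPath := π₂.bypass_isPath
  -- the even set `E(q₁) ∆ E(q₂)` is in the span; split it along "meets E₁"
  have hZeven : IsEvenEdgeSet (symmDiff (walkEdges q₁) (walkEdges q₂)) := by
    intro w
    rw [even_edgeDeg_symmDiff_iff, ← not_iff_not, Nat.not_even_iff_odd, Nat.not_even_iff_odd,
      odd_edgeDeg_walkEdges_iff hq₁path huv, odd_edgeDeg_walkEdges_iff hq₂path huv]
  have hZedges : ∀ e ∈ symmDiff (walkEdges q₁) (walkEdges q₂), e ∈ G.edgeSet := by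
    intro e he
    rw [mem_symmDiff] at he
    rcases he with ⟨h, -⟩ | ⟨h, -⟩
    · exact mem_edgeSet_of_mem_walkEdges q₁ h
    · exact mem_edgeSet_of_mem_walkEdges q₂ h
  obtain ⟨Za, Zb, hZa, hZb, hZeq⟩ := (hgen _ hZedges hZeven).split (fun C => ∃ e ∈ C, e ∈ E₁)
  by_contra hcon
  push Not at hcon
  -- `F := E(q₂) ∆ Zb` avoids `E₁`
  set F := symmDiff (walkEdges q₂) Zb with hF
  have hZbE₁ : ∀ e ∈ Zb, e ∉ E₁ := by
    intro e he heE₁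
    obtain ⟨C, ⟨_, hP⟩, heC⟩ := hZb.exists_mem he
    exact hP ⟨e, heC, heE₁⟩
  have hFE₁ : ∀ e ∈ F, e ∉ E₁ := by
    intro e he
    rw [hF, mem_symmDiff] at he
    rcases he with ⟨h, -⟩ | ⟨h, -⟩
    · exact hq₂E₁ e h
    · exact hZbE₁ e h
  have hZbE : ∀ e ∈ Zb, e ∈ G.edgeSet := fun e he => by
    obtain ⟨C, ⟨hC, -⟩, heC⟩ := hZb.exists_mem he; exact h𝒞E C hC e heC
  have hFdiag : ∀ e ∈ F, ¬e.IsDiag := by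
    intro e he
    rw [hF, mem_symmDiff] at he
    rcases he with ⟨h, -⟩ | ⟨h, -⟩
    · exact G.not_isDiag_of_mem_edgeSet (mem_edgeSet_of_mem_walkEdges q₂ h)
    · exact G.not_isDiag_of_mem_edgeSet (hZbE e h)
  -- cut parity: `∑_{v ∈ A} deg_F(v)` is odd
  have hZbeven : IsEvenEdgeSet Zb := hZb.isEvenEdgeSet fun C hC => h𝒞 C hC.1
  have hsum_q₂ : Odd (∑ v ∈ A, edgeDeg (walkEdges q₂) v) := by
    rw [← Finset.add_sum_erase A _ hu₁]
    refine Odd.add_even ((odd_edgeDeg_walkEdges_iff hq₂path huv u₁).2 (Or.inl rfl)) ?_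
    refine even_finsetSum _ fun v hv => ?_
    rw [Finset.mem_erase] at hv
    rw [← Nat.not_odd_iff_even, odd_edgeDeg_walkEdges_iff hq₂path huv]
    rintro (rfl | rfl)
    · exact hv.1 rfl
    · exact hv₁ hv.2
  have hsum_F : Odd (∑ v ∈ A, edgeDeg F v) := by
    have h := even_sum_edgeDeg_symmDiff_add (walkEdges q₂) Zb A
    have hZbsum : Even (∑ v ∈ A, edgeDeg Zb v) := even_finsetSum _ fun v _ => hZbeven v
    rw [← hF] at h
    rcases Nat.even_or_odd (∑ v ∈ A, edgeDeg F v) with hev | hodd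
    · exfalso
      have := (Nat.even_add.1 ((Nat.even_add.1 h).2 hZbsum))
      exact (Nat.not_even_iff_odd.2 hsum_q₂) (this.1 hev)
    · exact hodd
  have hcross : Odd #(F.filter (Crosses A)) := by
    have h := even_card_filter_crosses_add_sum_edgeDeg F hFdiag A
    rcases Nat.even_or_odd #(F.filter (Crosses A)) with hev | hodd
    · exact absurd ((Nat.even_add.1 h).1 hev) (Nat.not_even_iff_odd.2 hsum_F)
    · exact hodd
  -- hence `F` contains an edge of `E₂`, which must come from `Za`'s generators
  obtain ⟨f, hf⟩ : (F.filter (Crosses A)).Nonempty := Finset.card_pos.1 hcross.pos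
  rw [Finset.mem_filter] at hf
  have hfE : f ∈ G.edgeSet := by
    have := hf.1
    rw [hF, mem_symmDiff] at this
    rcases this with ⟨h, -⟩ | ⟨h, -⟩
    · exact mem_edgeSet_of_mem_walkEdges q₂ h
    · exact hZbE f h
  have hfE₂ : f ∈ E₂ := ((hE f).2 ⟨hfE, hf.2⟩).resolve_left (hFE₁ f hf.1)
  -- `F = E(q₁) ∆ Za`
  have hF' : F = symmDiff (walkEdges q₁) Za := by
    -- `Zb = Za ∆ (E(q₁) ∆ E(q₂))`
    have hZb : Zb = symmDiff Za (symmDiff (walkEdges q₁) (walkEdges q₂)) := by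
      rw [hZeq, symmDiff_symmDiff_cancel_left]
    rw [hF, hZb, symmDiff_left_comm, symmDiff_comm (walkEdges q₁) (walkEdges q₂),
      symmDiff_symmDiff_cancel_left, symmDiff_comm]
  have hfZa : f ∈ Za := by
    have := hf.1
    rw [hF', mem_symmDiff, hE₁q₁, Finset.mem_singleton] at this
    rcases this with ⟨h, -⟩ | ⟨h, -⟩
    · exact absurd (h ▸ hfE₂) (Finset.disjoint_left.1 h₁₂ he₁)
    · exact h
  obtain ⟨C, ⟨hC, hP⟩, hfC⟩ := hZa.exists_mem hfZa
  exact hcon C hC hP f hfC hfE₂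

end Timar

end Literature.Combinatorics.SimpleGraph.CycleSpace
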